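import Literature.Geometry.Symplectic.PALFProductStructure
import Literature.Geometry.Symplectic.PALFHeightFunction
import Literature.Topology.FourManifolds.BoundaryFieldGluing
import Literature.Topology.FourManifolds.AdaptedMorseFromInterior
import Mathlib.Analysis.InnerProductSpace.Basic
import HarnessLib

/-!
# The vertical boundary of a PALF and its inward fields

Topic `Literature/Geometry/Symplectic` (fact seat
`provefact-Literature.Geometry.Symplectic.Oba2016_s-add47373d4`; the inward Lyapunov field of
Kas' Morse function `A ∘ f + B` on the total space of a Lefschetz fibration over the disc —
Kas 1980, Gompf–Stipsicz 1999 §8.2, Oba 2016 §2.2 — in the tree's `PALF` vocabulary,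
`SteinPALF.lean`).  Everything is proved; no definitions, no named facts.

For a PALF `P : PALF o b` on the compact `W⁴` (`f = P.f : W → ℝ²`, `range f = 𝔻²`):

* §1 **the vertical boundary** (critical values lie in the open disc,
  `PALF.norm_apply_lt_one_of_mem_crit` of `PALFHeightFunction.lean`):
  `{‖f‖ = 1} ⊆ ∂W` (`mem_boundary_of_norm_eq_one`, Fermat at interior submersive points), and at
  such points `⟪df_x(v), f x⟫ < 0` for every strictly inward `v`
  (`inner_mfderiv_neg_of_norm_eq_one`, from
  `Literature.Topology.FourManifolds.mlineDeriv_neg_of_forall_le_of_mem_boundary` applied to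
  `⟪f ·, f x⟫ ≤ 1`);
* §2 **the horizontal boundary**: tangent preimages under `df` at boundary points with
  `‖f‖ < 1` (`exists_tangent_preimage_of_norm_lt_one`, `P.boundary_submersion`);
* §3 **the fields** (glued by `BoundaryFieldGluing.lean`): `exists_kernel_field_inward` — a
  smooth field in `ker df` over `{‖f‖ ≤ r}`, `r < 1`, strictly inward along the horizontal
  boundary there and weakly inward on all of `∂W` (the normal field `ν` of the fibres along
  `∂_h W`); `exists_tangent_field_lift` — a smooth field tangent to `∂W` with
  `df(X) = -θ(f) • f` over `{‖f‖ ≤ r}` for any smooth `θ` vanishing near the critical values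
  (the horizontal radial field `Z_h`).

## References

* A. Kas, *On the handlebody decomposition associated to a Lefschetz fibration*, Pacific J.
  Math. 89 (1980), §1–§2. [Kas1980]
* R. E. Gompf, A. I. Stipsicz, *4-Manifolds and Kirby Calculus*, GSM 20 (1999), §8.2.
  [GompfStipsiczGSM1999]
* T. Oba, *Stein fillings of homology 3-spheres and mapping class groups*, Geom. Dedicata 183
  (2016); arXiv:1407.5257, §2.2. [Oba2016]
-/

open scoped Manifold ContDiff Topology RealInnerProductSpace
open Set Function Filter

noncomputable section

namespace Literature.Geometry.Symplectic

open Literature.Topology.FourManifolds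

universe u

variable {W : Type u} [TopologicalSpace W] [ChartedSpace (EuclideanHalfSpace 4) W]
  [IsManifold (𝓡∂ 4) ∞ W]
  {o : SmoothOrientation (𝓡∂ 4) W} {b : BoundaryData (𝓡∂ 4) W (𝓡 3)} (P : PALF o b)

namespace PALF

/-! ### §1 The vertical boundary -/

/-- The height function `y ↦ ⟪a, f y⟫` has derivative `⟪a, df_x(·)⟫`. [folklore] -/
theorem hasMFDerivAt_inner_comp (a : EuclideanSpace ℝ (Fin 2)) (x : W) :
    HasMFDerivAt (𝓡∂ 4) 𝓘(ℝ, ℝ) (fun y => innerSL ℝ a (P.f y)) x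
      ((innerSL ℝ a).comp (mfderiv (𝓡∂ 4) 𝓘(ℝ, EuclideanSpace ℝ (Fin 2)) P.f x)) := by
  have hf : MDifferentiableAt (𝓡∂ 4) 𝓘(ℝ, EuclideanSpace ℝ (Fin 2)) P.f x :=
    P.contMDiff.mdifferentiableAt (by simp)
  exact ((innerSL ℝ a).hasFDerivAt.hasMFDerivAt).comp x hf.hasMFDerivAt

/-- The height function `y ↦ ⟪f x, f y⟫` is at most `1` when `‖f x‖ = 1`, with equality at `x`.
[folklore] -/
theorem inner_apply_le_of_norm_eq_one {x : W} (hx : ‖P.f x‖ = 1) (y : W) :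
    innerSL ℝ (P.f x) (P.f y) ≤ innerSL ℝ (P.f x) (P.f x) := by
  rw [innerSL_apply_apply, innerSL_apply_apply, real_inner_self_eq_norm_sq, hx, one_pow]
  calc ⟪P.f x, P.f y⟫ ≤ ‖P.f x‖ * ‖P.f y‖ := real_inner_le_norm _ _
    _ ≤ 1 * 1 := mul_le_mul hx.le (P.norm_apply_le_one y) (norm_nonneg _) zero_le_one
    _ = 1 := one_mul 1

/-- **The vertical boundary: `‖f x‖ = 1` forces `x ∈ ∂W`.**  At an interior point with
`‖f x‖ = 1` the height `⟪f x, ·⟫ ∘ f` has a maximum, hence is critical (Fermat), so `⟪f x, ·⟫`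
kills the image of `df_x` — which is everything, `x` being a regular point
(`norm_apply_lt_one_of_mem_crit`, `P.submersion`). [cite: Kas1980, §1] -/
theorem mem_boundary_of_norm_eq_one {x : W} (hx : ‖P.f x‖ = 1) : x ∈ (𝓡∂ 4).boundary W := by
  by_contra hxb
  have hxi : (𝓡∂ 4).IsInteriorPoint x :=
    ((𝓡∂ 4).isInteriorPoint_or_isBoundaryPoint x).resolve_right hxb
  have hxc : x ∉ P.crit := fun h => absurd hx (P.norm_apply_lt_one_of_mem_crit h).ne
  have hmax : IsLocalMax (fun y => innerSL ℝ (P.f x) (P.f y)) x :=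
    Filter.Eventually.of_forall fun y => P.inner_apply_le_of_norm_eq_one hx y
  have hcrit : IsMCriticalPt (𝓡∂ 4) (fun y => innerSL ℝ (P.f x) (P.f y)) x :=
    isMCriticalPt_of_isLocalMax hmax hxi
  have hzero := hcrit
  unfold IsMCriticalPt at hzero
  rw [(P.hasMFDerivAt_inner_comp (P.f x) x).mfderiv] at hzero
  obtain ⟨w, hw⟩ := P.submersion x hxc (P.f x)
  have h1 : innerSL ℝ (P.f x) (mfderiv (𝓡∂ 4) 𝓘(ℝ, EuclideanSpace ℝ (Fin 2)) P.f x w) = 0 := by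
    have := DFunLike.congr_fun hzero w
    exact this
  rw [hw, innerSL_apply_apply, real_inner_self_eq_norm_sq, hx] at h1
  norm_num at h1

/-- **At the vertical boundary, `df` of a strictly inward vector points into the disc**:
if `‖f x‖ = 1` and `v ∈ T_x W` is strictly inward then `⟪f x, df_x(v)⟫ < 0` — the height
`⟪f x, ·⟫ ∘ f ≤ 1` is maximal and regular at the boundary point `x`
(`Literature.Topology.FourManifolds.mlineDeriv_neg_of_forall_le_of_mem_boundary`). [cite: Kas1980, §1] -/
theorem inner_mfderiv_neg_of_norm_eq_one {x : W} (hx : ‖P.f x‖ = 1)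
    {v : TangentSpace (𝓡∂ 4) x} (hv : 0 < halfSpaceCoord 3 v) :
    innerSL ℝ (P.f x) (mfderiv (𝓡∂ 4) 𝓘(ℝ, EuclideanSpace ℝ (Fin 2)) P.f x v) < 0 := by
  have hxb : x ∈ (𝓡∂ 4).boundary W := P.mem_boundary_of_norm_eq_one hx
  have hxc : x ∉ P.crit := fun h => absurd hx (P.norm_apply_lt_one_of_mem_crit h).ne
  have hD := P.hasMFDerivAt_inner_comp (P.f x) x
  have hd : MDifferentiableAt (𝓡∂ 4) 𝓘(ℝ, ℝ) (fun y => innerSL ℝ (P.f x) (P.f y)) x :=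
    hD.mdifferentiableAt
  have hncrit : ¬ IsMCriticalPt (𝓡∂ 4) (fun y => innerSL ℝ (P.f x) (P.f y)) x := by
    intro hcrit
    unfold IsMCriticalPt at hcrit
    rw [hD.mfderiv] at hcrit
    obtain ⟨w, hw⟩ := P.submersion x hxc (P.f x)
    have h1 : innerSL ℝ (P.f x) (mfderiv (𝓡∂ 4) 𝓘(ℝ, EuclideanSpace ℝ (Fin 2)) P.f x w) = 0 := by
      have := DFunLike.congr_fun hcrit w
      exact this
    rw [hw, innerSL_apply_apply, real_inner_self_eq_norm_sq, hx] at h1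
    norm_num at h1
  have h := mlineDeriv_neg_of_forall_le_of_mem_boundary hd (P.inner_apply_le_of_norm_eq_one hx) hxb
    hncrit hv
  rw [mlineDeriv_def, hD.mfderiv] at h
  exact h

/-! ### §2 The horizontal boundary -/

/-- At a boundary point with `‖f x‖ < 1` the differential of the fibration map of a PALF is onto
already on the boundary tangent hyperplane `{v | v 0 = 0}` (`P.boundary_submersion` read
through the boundary datum). [cite: Kas1980, §1] -/
theorem exists_tangent_preimage_of_norm_lt_one {x : W} (hxb : x ∈ (𝓡∂ 4).boundary W)
    (hx : ‖P.f x‖ < 1) (w : EuclideanSpace ℝ (Fin 2)) :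
    ∃ v : EuclideanSpace ℝ (Fin 4), v 0 = 0 ∧ mfderiv (𝓡∂ 4) 𝓘(ℝ, EuclideanSpace ℝ (Fin 2)) P.f x v = w := by
  have hxr : x ∈ range b.incl := by rw [b.range_incl]; exact hxb
  obtain ⟨y, rfl⟩ := hxr
  have hs := P.boundary_submersion y hx
  have hg : MDifferentiableAt (𝓡∂ 4) 𝓘(ℝ, EuclideanSpace ℝ (Fin 2)) P.f (b.incl y) :=
    P.contMDiff.mdifferentiableAt (by simp)
  have hfd : MDifferentiableAt (𝓡 3) (𝓡∂ 4) b.incl y :=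
    b.isSmoothEmbedding.contMDiff.mdifferentiableAt (by simp)
  exact exists_apply_zero_eq_zero_and_mfderiv_eq (k := 3) b.incl_mem_boundary hg hfd hs w

/-! ### §3 The fields -/

variable [T2Space W] [CompactSpace W]

/-- **The normal field of the fibres along the horizontal boundary** (`ν`): for `r < 1` there
is a smooth vector field `X` on `W`, weakly inward at every boundary point, lying in `ker df`
over `{‖f‖ ≤ r}` and strictly inward at the boundary points there
(`Literature.Topology.FourManifolds.exists_contMDiff_kernel_field_inward` with the tangent preimages of
`exists_tangent_preimage_of_norm_lt_one`). [cite: Kas1980, §1] [cite: GompfStipsiczGSM1999, §8.2] -/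
theorem exists_kernel_field_inward {r : ℝ} (hr : r < 1) :
    ∃ X : Π x : W, TangentSpace (𝓡∂ 4) x,
      ContMDiff (𝓡∂ 4) (𝓡∂ 4).tangent ∞ (fun x => (⟨x, X x⟩ : TangentBundle (𝓡∂ 4) W)) ∧
      (∀ z ∈ (𝓡∂ 4).boundary W, 0 ≤ halfSpaceCoord 3 (X z)) ∧
      (∀ x, ‖P.f x‖ ≤ r → mfderiv (𝓡∂ 4) 𝓘(ℝ, EuclideanSpace ℝ (Fin 2)) P.f x (X x) = 0) ∧
      ∀ x, ‖P.f x‖ ≤ r → x ∈ (𝓡∂ 4).boundary W → 0 < halfSpaceCoord 3 (X x) := by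
  have hC : IsClosed {x : W | ‖P.f x‖ ≤ r} :=
    isClosed_le (continuous_norm.comp P.contMDiff.continuous) continuous_const
  obtain ⟨X, hXs, hXw, hXk, hXin⟩ := exists_contMDiff_kernel_field_inward (k := 3) P.contMDiff hC
    (fun x hx hxb w => P.exists_tangent_preimage_of_norm_lt_one hxb (lt_of_le_of_lt hx hr) w)
  exact ⟨X, hXs, hXw, fun x hx => hXk x hx, fun x hx hxb => hXin x hx hxb⟩

/-- **The horizontal lift of a radial base field** (`Z_h`): for `θ : ℝ² → ℝ` smooth and
vanishing near every critical value and `r < 1` there is a smooth vector field `X` on `W`,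
tangent to `∂W` at every boundary point, with `df_x(X x) = -θ(f x) • f x` whenever `‖f x‖ ≤ r`
(`Literature.Topology.FourManifolds.exists_contMDiff_lift_tangent'`: onto differential at the regular interior points,
vanishing right-hand side near the critical points, tangent preimages at the horizontal boundary).
[cite: Kas1980, §1] [cite: GompfStipsiczGSM1999, §8.2] -/
theorem exists_tangent_field_lift {θ : EuclideanSpace ℝ (Fin 2) → ℝ} (hθ : ContDiff ℝ ∞ θ)
    (hθc : ∀ p ∈ P.crit, ∀ᶠ u in 𝓝 (P.f p), θ u = 0) {r : ℝ} (hr : r < 1) :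
    ∃ X : Π x : W, TangentSpace (𝓡∂ 4) x,
      ContMDiff (𝓡∂ 4) (𝓡∂ 4).tangent ∞ (fun x => (⟨x, X x⟩ : TangentBundle (𝓡∂ 4) W)) ∧
      (∀ z ∈ (𝓡∂ 4).boundary W, halfSpaceCoord 3 (X z) = 0) ∧
      ∀ x, ‖P.f x‖ ≤ r →
        mfderiv (𝓡∂ 4) 𝓘(ℝ, EuclideanSpace ℝ (Fin 2)) P.f x (X x) = -(θ (P.f x)) • P.f x := by
  have hC : IsClosed {x : W | ‖P.f x‖ ≤ r} :=
    isClosed_le (continuous_norm.comp P.contMDiff.continuous) continuous_const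
  set c : W → EuclideanSpace ℝ (Fin 2) := fun x => -(θ (P.f x)) • P.f x with hc
  have hcs : ContMDiff (𝓡∂ 4) 𝓘(ℝ, EuclideanSpace ℝ (Fin 2)) ∞ c :=
    ((hθ.comp_contMDiff P.contMDiff).neg).smul P.contMDiff
  have hint : ∀ x ∈ {x : W | ‖P.f x‖ ≤ r}, (𝓡∂ 4).IsInteriorPoint x →
      Surjective (mfderiv (𝓡∂ 4) 𝓘(ℝ, EuclideanSpace ℝ (Fin 2)) P.f x) ∨
        ∃ U ∈ 𝓝 x, ∀ y ∈ U, c y = 0 := by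
    intro x _ _
    by_cases hxc : x ∈ P.crit
    · right
      refine ⟨P.f ⁻¹' {u | θ u = 0}, ?_, fun y hy => ?_⟩
      · exact P.contMDiff.continuous.continuousAt.preimage_mem_nhds (hθc x hxc)
      · have hy' : θ (P.f y) = 0 := hy
        simp only [hc, hy', neg_zero, zero_smul]
    · exact Or.inl (P.submersion x hxc)
  obtain ⟨X, hXs, hXt, hXl⟩ := exists_contMDiff_lift_tangent' (k := 3) P.contMDiff hcs hC hint
    (fun x hx hxb w => P.exists_tangent_preimage_of_norm_lt_one hxb (lt_of_le_of_lt hx hr) w)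
  exact ⟨X, hXs, hXt, fun x hx => hXl x hx⟩

end PALF

end Literature.Geometry.Symplectic

end
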